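/-
COR-CM (cell pub-hodgecm2, stage 2 of the Hodge ladder) — count-neutral KERNEL COMBINATORICS «the generalised-dihedral floor: for G = H ⋊ ⟨x⟩ with x
inverting H, 𝒦(G,c) = G, φ₂ = β − 2, so every generating face family has at least β − 2 members» (seat prover-pub-hodgecm2-b23-g46-0, binder prover
b23, gen 46; claim «SPLIT INDEX-TWO», HOME/INBOX.md l.20957).  Theorems only, on top of lit-andre-3ʼs `Census/TypeStabiliser*` and b09ʼs
`Census/CoinvariantFloor` (through `Census/OcticProductStabiliser` §4) BY NAME; no `decide`, no certificate, no named fact, no `sorry`; `Interfaces.lean`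
(C1), every E term, B01, `Transposition/*`, `PortJoin/*`, `D2Bridge/*` untouched.
HONEST FRAMING: `HC_CM` is NOT proved, here or anywhere in the tree; nothing here is a period, a count of record or a headline.
T5: n/a-class (hypothesis binders: `c * c = 1`, `c ≠ 1`, `c` central, `c ∈ H`, `H.index = 2`, `x ∉ H`, `∀ g ∉ H, g * g = 1`); checker: self.
-/
import Summits.HodgeConjecture.CorCM.Census.OcticProductStabiliser
import Summits.HodgeConjecture.CorCM.Census.IndexTwoDescentDictionary

/-!
# The generalised-dihedral floor: `μ(G, c) ≥ β(G, c) − 2` for `G = H ⋊ ⟨x⟩`, `x` inverting `H`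

Let `c ≠ 1` be a central involution of the finite group `G`, `H ∋ c` a subgroup of index two and suppose EVERY ELEMENT OUTSIDE `H` IS AN INVOLUTION
(`∀ g ∉ H, g·g = 1`) — equivalently `G = H ⋊ ⟨x⟩` with `x² = 1` acting on `H` by inversion (`coset_involutions_of_inverts`), so `H` is abelian and `G`
is the GENERALISED DIHEDRAL group `D(H)`: the dihedral groups `D_{2m}` (`c = r^{m/2}… ` any central involution in the rotation subgroup),
`D₄ × ℤ/2 = D(ℤ/4 × ℤ/2)`, `D(ℤ/4 × ℤ/4)`, `D(ℤ/2^e × B)`, … — twisted (`c ∈ 2H`) or not.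

* §1 `𝒦(G, c) = G` (`stabGen_eq_top_of_coset_involutions`): the involutions outside `H` lie in `𝒦` (lit-andre-3ʼs `mem_stabGen_of_mul_self_eq_one`)
  and every `h ∈ H` is the product `x · (x h)` of two of them; hence `d₂(G/𝒦) = 0`.
* §2 **`β(G, c) = φ₂(G, c) + 2`** (`card_block_eq_fibreTwo_add_two_of_coset_involutions`; lit-andre-3ʼs closed form, `|G|/2 = |H|` even).
* §3 **THE FLOOR** (`card_block_le_card_add_two_of_coset_involutions`, b09ʼs coinvariant floor): every family `S` of faces whose base changes
  generate `hodgeSpan (G, c)` modulo pairs has **`β(G, c) ≤ |S| + 2`**, i.e. `μ(D(H), c) ≥ β − 2` for every generalised dihedral CM type;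
  `card_block_sub_two_mem_lowerBounds`.  The matching existence `μ(D(H), c) ≤ β − 2` is the DIHEDRAL LAW of the design note
  `HOME/pub-hodgecm2-b23/SPLIT-INDEX-TWO.md` (kernel for `D₄`, `D(ℤ/4 × ℤ/m)`, `m` odd — gen 44; numerically for `D₈`, `D₄ × ℤ/2`, `D₁₂`, `D₁₀`, …).

## References
* [Pohlmann1968] H. Pohlmann, Algebraic cycles on abelian varieties of complex multiplication type, Ann. of Math. 88 (1968), Thm 1.
-/

namespace Summit.HodgeConjecture.CorCM.Census.IndexTwoDescent

open Finset
open Summit.HodgeConjecture.CorCM.Prior.AllgGroup.RfwfAllgGroup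
open Summit.HodgeConjecture.CorCM.Census.BlockParity
open Summit.HodgeConjecture.CorCM.Census.Coinvariant
open Summit.HodgeConjecture.CorCM.Census.TypeStabiliser
open Summit.HodgeConjecture.CorCM.Census.IndexTwo

noncomputable section

variable {G : Type*} [Group G] [Fintype G] [DecidableEq G] {c : G}
variable {H : Subgroup G}

omit [Fintype G] [DecidableEq G] in
/-- If `x ∉ H` inverts `H` (`x h x = h⁻¹`), then every element outside `H` is an involution. [folklore] -/
theorem coset_involutions_of_inverts (hH : H.index = 2) {x : G} (hx : x ∉ H)
    (hinv : ∀ h : H, x * (h : G) * x = ((h : G))⁻¹) (g : G) (hg : g ∉ H) : g * g = 1 := by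
  obtain ⟨h, rfl⟩ := exists_eq_mul_of_not_mem hH hx hg
  rw [show x * (h : G) * (x * (h : G)) = (x * (h : G) * x) * (h : G) by group, hinv h, inv_mul_cancel]

omit [Fintype G] [DecidableEq G] in
/-- Conversely, if every element outside `H` is an involution then `x` inverts `H`. [folklore] -/
theorem inverts_of_coset_involutions {x : G} (hx : x ∉ H) (hinvol : ∀ g : G, g ∉ H → g * g = 1) (h : H) :
    x * (h : G) * x = ((h : G))⁻¹ := by
  have hxh : x * (h : G) * (x * (h : G)) = 1 := hinvol _ (mul_coe_not_mem hx h)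
  have hxx : x * x = 1 := hinvol x hx
  rw [show x * (h : G) * (x * (h : G)) = (x * (h : G) * x) * (h : G) by group] at hxh
  exact eq_inv_of_mul_eq_one_left hxh

/-! ## §1 `𝒦(G, c) = G` -/

omit [Fintype G] [DecidableEq G] in
/-- **`𝒦(G, c) = G`** when every element outside an index-two subgroup is an involution: the outside involutions lie in `𝒦`, and every
`h ∈ H` is a product `x · (x h)` of two of them. [folklore] -/
theorem stabGen_eq_top_of_coset_involutions (hc1 : c ≠ 1) (hH : H.index = 2) {x : G} (hx : x ∉ H)
    (hinvol : ∀ g : G, g ∉ H → g * g = 1) : stabGen c = ⊤ := by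
  refine top_unique fun g _ => ?_
  by_cases hg : g ∈ H
  · have hxg : x * g ∉ H := (mul_mem_iff_not_mem hH hx g).not.mpr (not_not.mpr hg)
    have e : g = x * (x * g) := by rw [← mul_assoc, hinvol x hx, one_mul]
    rw [e]
    exact (stabGen c).mul_mem (mem_stabGen_of_mul_self_eq_one c hc1 (hinvol x hx))
      (mem_stabGen_of_mul_self_eq_one c hc1 (hinvol _ hxg))
  · exact mem_stabGen_of_mul_self_eq_one c hc1 (hinvol g hg)

omit [Fintype G] [DecidableEq G] in
/-- Hence `d₂(G/𝒦) = 0`. [folklore] -/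
theorem indexTwoRank_stabGen_eq_zero_of_coset_involutions (hc1 : c ≠ 1) (hH : H.index = 2) {x : G} (hx : x ∉ H)
    (hinvol : ∀ g : G, g ∉ H → g * g = 1) : indexTwoRank (stabGen c) = 0 := by
  rw [stabGen_eq_top_of_coset_involutions hc1 hH hx hinvol]; exact indexTwoRank_top

/-! ## §2 `β = φ₂ + 2` -/

omit [DecidableEq G] in
/-- `|G|/2 = |H|` is even for an index-two subgroup containing the involution `c ≠ 1`. [folklore] -/
theorem even_card_div_two (hcH : c ∈ H) (hc2 : c * c = 1) (hc1 : c ≠ 1) (hH : H.index = 2) : Even (Fintype.card G / 2) := by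
  have hcard : 2 * Nat.card H = Fintype.card G := by
    rw [← Nat.card_eq_fintype_card, ← hH]; exact Subgroup.index_mul_card H
  have hord : orderOf (⟨c, hcH⟩ : H) = 2 :=
    orderOf_eq_prime (by rw [pow_two]; exact csub_mul_csub hcH hc2) (csub_ne_one hcH hc1)
  have hdvd : 2 ∣ Nat.card H := hord ▸ orderOf_dvd_natCard (⟨c, hcH⟩ : H)
  obtain ⟨m, hm⟩ := hdvd
  refine ⟨m, ?_⟩
  omega

/-- **`β(G, c) = φ₂(G, c) + 2`** for the generalised dihedral situation. [folklore] -/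
theorem card_block_eq_fibreTwo_add_two_of_coset_involutions (hcH : c ∈ H) (hc2 : c * c = 1) (hc1 : c ≠ 1)
    (hcen : ∀ g : G, g * c = c * g) (hH : H.index = 2) {x : G} (hx : x ∉ H) (hinvol : ∀ g : G, g ∉ H → g * g = 1) :
    Fintype.card (Block c) = fibreTwo c hc2 + 2 := by
  have h := fibreTwo_add_two_eq_card_block_add_indexTwoRank c hc2 hc1 hcen (even_card_div_two hcH hc2 hc1 hH)
  rw [indexTwoRank_stabGen_eq_zero_of_coset_involutions hc1 hH hx hinvol, add_zero] at h
  exact h.symm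

/-! ## §3 The floor -/

/-- **THE GENERALISED-DIHEDRAL FLOOR `μ(G, c) ≥ β(G, c) − 2`**: for `c ≠ 1` central, `H ∋ c` of index two and every element outside `H` an
involution, every family `S` of faces whose base changes generate the Hodge span modulo pairs has `β(G, c) ≤ |S| + 2`. [folklore] -/
theorem card_block_le_card_add_two_of_coset_involutions (hcH : c ∈ H) (hc2 : c * c = 1) (hc1 : c ≠ 1)
    (hcen : ∀ g : G, g * c = c * g) (hH : H.index = 2) {x : G} (hx : x ∉ H) (hinvol : ∀ g : G, g ∉ H → g * g = 1)
    (S : Finset (CMF G c →₀ ℤ)) (hSF : (S : Set (CMF G c →₀ ℤ)) ⊆ gfaceSet G c hc2)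
    (hgen : hodgeSpan c hc2 ≤ Submodule.span ℤ (pairSet c) ⊔ Submodule.span ℤ (translates c S)) :
    Fintype.card (Block c) ≤ S.card + 2 := by
  have hfloor := OcticProduct.fibreTwo_mem_lowerBounds hc2 hcen ⟨S, hSF, rfl, hgen⟩
  rw [card_block_eq_fibreTwo_add_two_of_coset_involutions hcH hc2 hc1 hcen hH hx hinvol]
  omega

/-- The floor in `lowerBounds` form: `β(G, c) − 2` bounds below the cardinality of every generating face family. [folklore] -/
theorem card_block_sub_two_mem_lowerBounds (hcH : c ∈ H) (hc2 : c * c = 1) (hc1 : c ≠ 1)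
    (hcen : ∀ g : G, g * c = c * g) (hH : H.index = 2) {x : G} (hx : x ∉ H) (hinvol : ∀ g : G, g ∉ H → g * g = 1) :
    Fintype.card (Block c) - 2 ∈ lowerBounds {m : ℕ | ∃ S : Finset (CMF G c →₀ ℤ), ↑S ⊆ gfaceSet G c hc2 ∧ S.card = m ∧
      hodgeSpan c hc2 ≤ Submodule.span ℤ (pairSet c) ⊔ Submodule.span ℤ (translates c S)} := by
  rintro m ⟨S, hSF, rfl, hgen⟩
  have h := card_block_le_card_add_two_of_coset_involutions hcH hc2 hc1 hcen hH hx hinvol S hSF hgen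
  omega

/-- The same floor stated for `x` inverting `H` (`x h x = h⁻¹`, so `x² = 1`): `G = D(H)`. [folklore] -/
theorem card_block_le_card_add_two_of_inverts (hcH : c ∈ H) (hc2 : c * c = 1) (hc1 : c ≠ 1)
    (hcen : ∀ g : G, g * c = c * g) (hH : H.index = 2) {x : G} (hx : x ∉ H)
    (hinv : ∀ h : H, x * (h : G) * x = ((h : G))⁻¹)
    (S : Finset (CMF G c →₀ ℤ)) (hSF : (S : Set (CMF G c →₀ ℤ)) ⊆ gfaceSet G c hc2)
    (hgen : hodgeSpan c hc2 ≤ Submodule.span ℤ (pairSet c) ⊔ Submodule.span ℤ (translates c S)) :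
    Fintype.card (Block c) ≤ S.card + 2 :=
  card_block_le_card_add_two_of_coset_involutions hcH hc2 hc1 hcen hH hx (coset_involutions_of_inverts hH hx hinv) S hSF hgen

/-! ## §4 Generalisation: no element outside `H` has `c` among its powers -/

omit [Fintype G] [DecidableEq G] in
/-- **`𝒦(G, c) = G`** as soon as NO element outside the index-two subgroup `H` has `c` among its powers (`∀ g ∉ H, c ∉ ⟨g⟩`): such elements lie in
`𝒦` (lit-andre-3ʼs `mem_stabGen_of_notMem_zpowers`) and every `h ∈ H` is a product `x · (x⁻¹ h)` of two of them.  Covers the generalised dihedral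
groups (every outside element an involution) and e.g. `(ℤ/2^e × B) ⋊ ⟨x⟩` with `x` inverting `ℤ/2^e` and acting by any involution on the odd `B`
(`D₄ × B`, …): there `(x h)²` has odd order. [folklore] -/
theorem stabGen_eq_top_of_coset_avoids (hH : H.index = 2) {x : G} (hx : x ∉ H)
    (havoid : ∀ g : G, g ∉ H → c ∉ Subgroup.zpowers g) : stabGen c = ⊤ := by
  refine top_unique fun g _ => ?_
  by_cases hg : g ∈ H
  · have hxi : x⁻¹ ∉ H := fun h => hx (by simpa using H.inv_mem h)
    have hxg : x⁻¹ * g ∉ H := (inv_mul_mem_iff_not_mem hH hx g).not.mpr (not_not.mpr hg)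
    have e : g = x * (x⁻¹ * g) := by rw [mul_inv_cancel_left]
    rw [e]
    exact (stabGen c).mul_mem (mem_stabGen_of_notMem_zpowers c (havoid x hx)) (mem_stabGen_of_notMem_zpowers c (havoid _ hxg))
  · exact mem_stabGen_of_notMem_zpowers c (havoid g hg)

/-- **`β(G, c) = φ₂(G, c) + 2`** when no element outside `H` has `c` among its powers. [folklore] -/
theorem card_block_eq_fibreTwo_add_two_of_coset_avoids (hcH : c ∈ H) (hc2 : c * c = 1) (hc1 : c ≠ 1)
    (hcen : ∀ g : G, g * c = c * g) (hH : H.index = 2) {x : G} (hx : x ∉ H) (havoid : ∀ g : G, g ∉ H → c ∉ Subgroup.zpowers g) :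
    Fintype.card (Block c) = fibreTwo c hc2 + 2 := by
  have h := fibreTwo_add_two_eq_card_block_add_indexTwoRank c hc2 hc1 hcen (even_card_div_two hcH hc2 hc1 hH)
  rw [stabGen_eq_top_of_coset_avoids hH hx havoid, indexTwoRank_top, add_zero] at h
  exact h.symm

/-- **THE FLOOR `μ(G, c) ≥ β(G, c) − 2`** when no element outside the index-two subgroup `H ∋ c` has `c` among its powers. [folklore] -/
theorem card_block_le_card_add_two_of_coset_avoids (hcH : c ∈ H) (hc2 : c * c = 1) (hc1 : c ≠ 1)
    (hcen : ∀ g : G, g * c = c * g) (hH : H.index = 2) {x : G} (hx : x ∉ H) (havoid : ∀ g : G, g ∉ H → c ∉ Subgroup.zpowers g)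
    (S : Finset (CMF G c →₀ ℤ)) (hSF : (S : Set (CMF G c →₀ ℤ)) ⊆ gfaceSet G c hc2)
    (hgen : hodgeSpan c hc2 ≤ Submodule.span ℤ (pairSet c) ⊔ Submodule.span ℤ (translates c S)) :
    Fintype.card (Block c) ≤ S.card + 2 := by
  have hfloor := OcticProduct.fibreTwo_mem_lowerBounds hc2 hcen ⟨S, hSF, rfl, hgen⟩
  rw [card_block_eq_fibreTwo_add_two_of_coset_avoids hcH hc2 hc1 hcen hH hx havoid]
  omega

/-- The floor in `lowerBounds` form under the same hypothesis. [folklore] -/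
theorem card_block_sub_two_mem_lowerBounds_of_coset_avoids (hcH : c ∈ H) (hc2 : c * c = 1) (hc1 : c ≠ 1)
    (hcen : ∀ g : G, g * c = c * g) (hH : H.index = 2) {x : G} (hx : x ∉ H) (havoid : ∀ g : G, g ∉ H → c ∉ Subgroup.zpowers g) :
    Fintype.card (Block c) - 2 ∈ lowerBounds {m : ℕ | ∃ S : Finset (CMF G c →₀ ℤ), ↑S ⊆ gfaceSet G c hc2 ∧ S.card = m ∧
      hodgeSpan c hc2 ≤ Submodule.span ℤ (pairSet c) ⊔ Submodule.span ℤ (translates c S)} := by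
  rintro m ⟨S, hSF, rfl, hgen⟩
  have h := card_block_le_card_add_two_of_coset_avoids hcH hc2 hc1 hcen hH hx havoid S hSF hgen
  omega

/-! ## §5 The block count (Burnside) for the coset-involution case -/

omit [Fintype G] [DecidableEq G] in
/-- An element outside `H` (hence an involution `≠ 1, ≠ c`) has `c ∉ ⟨g⟩` and order `2`. [folklore] -/
theorem coset_involution_aux (hcH : c ∈ H) (hc1 : c ≠ 1) {g : G} (hg : g ∉ H) (hinvol : ∀ g : G, g ∉ H → g * g = 1) :
    c ∉ Subgroup.zpowers g ∧ orderOf g = 2 := by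
  have hg1 : g ≠ 1 := fun h => hg (h ▸ H.one_mem)
  have hgc : g ≠ c := fun h => hg (h ▸ hcH)
  exact ⟨notMem_zpowers_of_mul_self_eq_one c (hinvol g hg) hc1 hgc,
    orderOf_eq_prime (by rw [pow_two]; exact hinvol g hg) hg1⟩

/-- **THE BLOCK COUNT** when every element outside the index-two subgroup `H ∋ c` is an involution (`c` central):
`β(G,c)·|G| = Σ_{h ∈ H} [c ∉ ⟨h⟩]·2^{|G|/(2·ord h)} + (|G|/2)·2^{|G|/4}` — Burnside (`BlockParity.card_block_mul_card`): an involution outside `H`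
fixes `2^{|G|/4}` types. [folklore] -/
theorem card_block_mul_card_of_coset_involutions [DecidablePred (· ∈ H)] (hcH : c ∈ H) (hc2 : c * c = 1) (hc1 : c ≠ 1)
    (hcen : ∀ g : G, g * c = c * g) (hH : H.index = 2) (hinvol : ∀ g : G, g ∉ H → g * g = 1) :
    Fintype.card (Block c) * Fintype.card G =
      (∑ g ∈ Finset.univ.filter (fun g : G => g ∈ H), if c ∈ Subgroup.zpowers g then 0 else 2 ^ (Fintype.card G / orderOf g / 2)) +
        Fintype.card G / 2 * 2 ^ (Fintype.card G / 4) := by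
  classical
  rw [card_block_mul_card c hc2 hcen, ← Finset.sum_filter_add_sum_filter_not Finset.univ (fun g : G => g ∈ H)]
  congr 1
  have hconst : ∀ g ∈ Finset.univ.filter (fun g : G => ¬ g ∈ H),
      (if c ∈ Subgroup.zpowers g then 0 else 2 ^ (Fintype.card G / orderOf g / 2)) = 2 ^ (Fintype.card G / 4) := by
    intro g hg
    obtain ⟨hcz, hord⟩ := coset_involution_aux hcH hc1 (Finset.mem_filter.mp hg).2 hinvol
    rw [if_neg hcz, hord, Nat.div_div_eq_div_mul]
  rw [Finset.sum_congr rfl hconst, Finset.sum_const, smul_eq_mul]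
  congr 1
  -- the complement of `H` has `|G|/2` elements
  have hcardH : (Finset.univ.filter (fun g : G => g ∈ H)).card = Nat.card H := by
    rw [Nat.card_eq_fintype_card, Fintype.card_subtype]
  have hidx : 2 * Nat.card H = Fintype.card G := by
    rw [← Nat.card_eq_fintype_card, ← hH]; exact Subgroup.index_mul_card H
  have hsum := Finset.card_filter_add_card_filter_not (s := Finset.univ) (fun g : G => g ∈ H)
  rw [Finset.card_univ, hcardH] at hsum
  omega

/-- **THE BLOCK COUNT, quotient form**: `β(G,c) = (Σ_{h ∈ H} [c ∉ ⟨h⟩]·2^{|G|/(2·ord h)} + (|G|/2)·2^{|G|/4}) / |G|`. [folklore] -/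
theorem card_block_eq_of_coset_involutions [DecidablePred (· ∈ H)] (hcH : c ∈ H) (hc2 : c * c = 1) (hc1 : c ≠ 1)
    (hcen : ∀ g : G, g * c = c * g) (hH : H.index = 2) (hinvol : ∀ g : G, g ∉ H → g * g = 1) :
    Fintype.card (Block c) =
      ((∑ g ∈ Finset.univ.filter (fun g : G => g ∈ H), if c ∈ Subgroup.zpowers g then 0 else 2 ^ (Fintype.card G / orderOf g / 2)) +
        Fintype.card G / 2 * 2 ^ (Fintype.card G / 4)) / Fintype.card G := by
  rw [← card_block_mul_card_of_coset_involutions hcH hc2 hc1 hcen hH hinvol, Nat.mul_div_cancel _ Fintype.card_pos]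

/-- **THE GENERALISED-DIHEDRAL FLOOR IN CLOSED FORM**: under the same hypotheses every generating face family `S` satisfies
`(Σ_{h ∈ H} [c ∉ ⟨h⟩]·2^{|G|/(2·ord h)} + (|G|/2)·2^{|G|/4}) / |G| ≤ |S| + 2`. [folklore] -/
theorem closedForm_le_card_add_two_of_coset_involutions [DecidablePred (· ∈ H)] (hcH : c ∈ H) (hc2 : c * c = 1) (hc1 : c ≠ 1)
    (hcen : ∀ g : G, g * c = c * g) (hH : H.index = 2) {x : G} (hx : x ∉ H) (hinvol : ∀ g : G, g ∉ H → g * g = 1)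
    (S : Finset (CMF G c →₀ ℤ)) (hSF : (S : Set (CMF G c →₀ ℤ)) ⊆ gfaceSet G c hc2)
    (hgen : hodgeSpan c hc2 ≤ Submodule.span ℤ (pairSet c) ⊔ Submodule.span ℤ (translates c S)) :
    ((∑ g ∈ Finset.univ.filter (fun g : G => g ∈ H), if c ∈ Subgroup.zpowers g then 0 else 2 ^ (Fintype.card G / orderOf g / 2)) +
        Fintype.card G / 2 * 2 ^ (Fintype.card G / 4)) / Fintype.card G ≤ S.card + 2 := by
  rw [← card_block_eq_of_coset_involutions hcH hc2 hc1 hcen hH hinvol]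
  exact card_block_le_card_add_two_of_coset_involutions hcH hc2 hc1 hcen hH hx hinvol S hSF hgen

end

end Summit.HodgeConjecture.CorCM.Census.IndexTwoDescent
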